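import Summits.MatrixMultiplication.MatrixMultiplication.Theorems.ObstructionDescentInvariantTower
import Literature.Computability.AlgebraicComplexity.QuantumFunctionalsSemiInvariant

set_option linter.dupNamespace false

/-!
# The Levi–Weyl law for weight vectors (decomp-mm · lens 3 · gen 13, hand laws of gen 12 made kernel)

Route `route-MatrixMultiplication-ObstructionDescent`, support for the aside `InvariantSaturation` (item
`stmt-MatrixMultiplication-32282`) and for the obstruction calculus beneath the crux `NoOccurrenceObstruction`
(item `stmt-MatrixMultiplication-29040`); continues `ObstructionDescentInvariantTower` (`rectType`, `pointLevels`).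

**The law.**  A weight vector `f ∈ hwvSpace Λ d` is, by definition, only a `B_m³`-eigenvector (upper-triangular
substitutions).  This file proves, with no Lie theory and no complete reducibility, that `f` is automatically
(semi-)invariant under the whole LEVI FACTOR of its type: for a slot `s` and two indices `i ≠ j` carrying the SAME
exponent `Λ s i = Λ s j`,
* (A) `f(E_{ij}(u)·x) = f(x)` for every `u` — invariance under the root group in BOTH directions
  (`evalT_slotAct_transvection`; the upper direction is the Borel axiom, the lower one is the theorem);
* (B) `f(P_{(i j)}·x) = (−1)^{Λ s i} · f(x)` — the SIGN LAW for the transposition matrix (`evalT_slotAct_swap`), and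
  for every permutation `σ` supported inside one level set `{a | Λ s a = ℓ}`:
  `f(P_σ·x) = sign(σ)^ℓ · f(x)` (`evalT_slotAct_permMatrix`).
The engine is Chevalley's `SL₂` relation written inside `GL_m`,
`E_{ji}(c⁻¹) = E_{ij}(c) · diag(−c at i, c⁻¹ at j) · E_{ji}(c) · P_{(i j)}` (`transvection_inv_eq_prod`), whose first
two factors are Borel with character `(−c)^{λ_i}(c⁻¹)^{λ_j} = (−1)^ℓ`; hence `P(c⁻¹) = (−1)^ℓ Q(c)` for the two
polynomial restrictions `P(u) = f(E_{ji}(u)·x)`, `Q(u) = f(E_{ji}(u)·P_{(i j)}·x)`, and a polynomial in `c⁻¹` that equals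
a polynomial in `c` on `ℂ^×` is constant (`eval_eq_eval_zero_of_eval_inv_eq`, via `Polynomial.reflect`).

**Consequences for the invariant tower** (rectangular types `rectType m N k`: exponent `k` on the corner block
`{a | m ≤ a + N}`, `0` before it — BOTH blocks are level sets):
* (C) ODD-SYMMETRY VANISHING (the «(PP) law» of NODE-g12 §3, there a hand law): if a tensor `x` is fixed by a
  simultaneous relabelling `x_{σa,σb,σc} = x_{abc}` by an ODD permutation `σ` supported in the corner, then every weight
  vector of an ODD level `k` vanishes at `x` (`f(x) = sign(σ)^{3k} f(x) = −f(x)`): `evalT_eq_zero_of_oddSymmetry`,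
  `not_mem_pointLevels_of_oddSymmetry`.  Instances: two identical odd-size diagonal blocks `p ⊕ p` inside the corner
  (block swap, `sign = (−1)^{a}`), in particular `⟨2⟩ ⊕ …`; this is the kernel form of the parity constraints used in the
  level censuses T15–T18.
* (D) The levels of a point `pointLevels N t` (BI17's `E'(t)`) are invariant under one-slot Borel moves, under the
  corner / off-corner root groups and under corner permutations (`pointLevels_slotAct_borel/transvection/permMatrix`) —
  i.e. under generators of the block Levi `(GL_{m−N} × GL_N)³`, as the hand arguments of gens 10–12 assumed.
All hypotheses inline; no proposition defined; no `sorry`; standard axioms.  Nothing here proves `ω = 2`.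
[cite: BurgisserIkenmeyer2011, §3.1–3.2 (highest weight vectors as `B`-eigenvectors); BurgisserIkenmeyer2017, §5 (5.2),
Thm 5.3 (`E'(w)`, stabiliser periods); Grosshans1997, Cor. 3.6 (the stabiliser of a highest weight vector is `P_χ`,
`U_{−α} ⊆ P_χ` iff `(χ,α) = 0` — the Lie-theoretic form of (A)); folklore: Chevalley `SL₂` relation
`e_{−α}(−t⁻¹) = e_α(−t)·α^∨(t)·w_α·e_α(−t)`]
-/

noncomputable section

open scoped BigOperators
open Finset

namespace Summit.MatrixMultiplication.MatrixMultiplication.Theorems.ObstructionCalculus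

open Literature.Computability.AlgebraicComplexity (actTensor actTensor_actTensor actTensor_one
  actTensor_one_add_smul_fst actTensor_one_add_smul_snd actTensor_one_add_smul_thd)

section LeviWeyl

variable {m : ℕ}

/-! ### 1 · Two algebraic lemmas: Laurent rigidity, restriction to a line -/

/-- LAURENT RIGIDITY.  If two polynomials satisfy `P(c⁻¹) = Q(c)` for every `c ≠ 0`, both are the constant `P(0)`:
the reflection of `P` equals `X^{deg P}·Q`, and comparing constant coefficients forces `deg P = 0`. [folklore] -/
theorem eval_eq_eval_zero_of_eval_inv_eq {P Q : Polynomial ℂ}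
    (h : ∀ c : ℂ, c ≠ 0 → P.eval c⁻¹ = Q.eval c) (u : ℂ) :
    P.eval u = P.eval 0 ∧ Q.eval u = P.eval 0 := by
  classical
  haveI : Infinite ℂ := Infinite.of_injective _ Nat.cast_injective
  have hinf : ∀ {R S : Polynomial ℂ}, (∀ c : ℂ, c ≠ 0 → R.eval c = S.eval c) → R = S := by
    intro R S hRS
    refine Polynomial.eq_of_infinite_eval_eq R S ?_
    exact ((Set.finite_singleton (0 : ℂ)).infinite_compl).mono fun c hc =>
      hRS c (by simpa only [Set.mem_compl_iff, Set.mem_singleton_iff] using hc)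
  set N := P.natDegree with hN
  have hrefl : Polynomial.reflect N P = Polynomial.X ^ N * Q := by
    refine hinf fun c hc => ?_
    letI : Invertible (c⁻¹) := invertibleOfNonzero (inv_ne_zero hc)
    have key : (Polynomial.reflect N P).eval (⅟ (c⁻¹)) * c⁻¹ ^ N = P.eval c⁻¹ :=
      Polynomial.eval₂_reflect_mul_pow (RingHom.id ℂ) c⁻¹ N P (le_of_eq hN.symm)
    rw [invOf_eq_inv, inv_inv, h c hc] at key
    rw [Polynomial.eval_mul, Polynomial.eval_pow, Polynomial.eval_X, ← key, mul_left_comm, ← mul_pow,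
      mul_inv_cancel₀ hc, one_pow, mul_one]
  have hN0 : N = 0 := by
    by_contra hN0
    have h0 := congrArg (fun R : Polynomial ℂ => R.coeff 0) hrefl
    simp only [Polynomial.coeff_reflect, Polynomial.revAt_zero, Polynomial.coeff_X_pow_mul',
      Nat.le_zero, hN0, if_false] at h0
    have hP0 : P = 0 := Polynomial.leadingCoeff_eq_zero.1 (by rw [Polynomial.leadingCoeff, ← hN]; exact h0)
    exact hN0 (by rw [hN, hP0, Polynomial.natDegree_zero])
  have hPC : P = Polynomial.C (P.coeff 0) := Polynomial.eq_C_of_natDegree_eq_zero (hN.symm.trans hN0)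
  have hPu : ∀ v, P.eval v = P.coeff 0 := fun v => by
    rw [hPC]
    simp only [Polynomial.eval_C, Polynomial.coeff_C_zero]
  have hQC : Q = Polynomial.C (P.coeff 0) :=
    hinf fun c hc => by rw [← h c hc, hPu, Polynomial.eval_C]
  refine ⟨by rw [hPu, hPu], ?_⟩
  rw [hQC, Polynomial.eval_C, hPu]

/-- RESTRICTION TO A LINE.  `u ↦ f(x + u·y)` is a polynomial function of `u`. [folklore] -/
theorem exists_polynomial_evalT_line (f : MvPolynomial (Idx m) ℂ) (x y : Tensor ℂ m) :
    ∃ P : Polynomial ℂ, ∀ u : ℂ, evalT (x + u • y) f = P.eval u := by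
  refine ⟨MvPolynomial.aeval (fun p : Idx m => Polynomial.C (x p.1 p.2.1 p.2.2) +
      Polynomial.C (y p.1 p.2.1 p.2.2) * Polynomial.X) f, fun u => ?_⟩
  rw [← Polynomial.coe_aeval_eq_eval, ← AlgHom.comp_apply, MvPolynomial.comp_aeval]
  have hfun : (fun p : Idx m => (Polynomial.aeval u) (Polynomial.C (x p.1 p.2.1 p.2.2) +
      Polynomial.C (y p.1 p.2.1 p.2.2) * Polynomial.X)) = fun p => (x + u • y) p.1 p.2.1 p.2.2 := by
    funext p
    simp only [map_add, map_mul, Polynomial.aeval_C, Polynomial.aeval_X, Pi.add_apply, Pi.smul_apply,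
      smul_eq_mul, Algebra.algebraMap_self_apply]
    ring
  rw [hfun]
  rfl

/-! ### 2 · One-slot action algebra -/

/-- One-slot actions compose: `X·(Y·t) = (XY)·t` in the same slot. [bookkeeping] -/
theorem slotAct_mul (X Y : Matrix (Fin m) (Fin m) ℂ) (t : Tensor ℂ m) :
    ∀ s : Fin 3, slotAct s X (slotAct s Y t) = slotAct s (X * Y) t :=
  forall_fin_three.2
    ⟨by simp only [slotAct_zero, actTensor_actTensor, Matrix.one_mul],
     by simp only [slotAct_one, actTensor_actTensor, Matrix.one_mul],
     by simp only [slotAct_two, actTensor_actTensor, Matrix.one_mul]⟩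

/-- The identity matrix acts trivially in every slot. [bookkeeping] -/
theorem slotAct_id (t : Tensor ℂ m) : ∀ s : Fin 3, slotAct s (1 : Matrix (Fin m) (Fin m) ℂ) t = t :=
  forall_fin_three.2
    ⟨by rw [slotAct_zero, actTensor_one], by rw [slotAct_one, actTensor_one], by rw [slotAct_two, actTensor_one]⟩

/-- A unipotent one-slot action `1 + u·E` translates along the direction `E·t`. [folklore] -/
theorem slotAct_one_add_smul (u : ℂ) (E : Matrix (Fin m) (Fin m) ℂ) (t : Tensor ℂ m) :
    ∀ s : Fin 3, slotAct s (1 + u • E) t = t + u • slotAct s E t :=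
  forall_fin_three.2
    ⟨by rw [slotAct_zero, slotAct_zero, actTensor_one_add_smul_fst],
     by rw [slotAct_one, slotAct_one, actTensor_one_add_smul_snd],
     by rw [slotAct_two, slotAct_two, actTensor_one_add_smul_thd]⟩

/-- The root group `E_{ij}(u) = 1 + u·e_{ij}` acts along the line through `t` with direction `e_{ij}·t`. [folklore] -/
theorem slotAct_transvection (i j : Fin m) (u : ℂ) (t : Tensor ℂ m) (s : Fin 3) :
    slotAct s (Matrix.transvection i j u) t = t + u • slotAct s (Matrix.single i j (1 : ℂ)) t := by
  have h : Matrix.transvection i j u = 1 + u • Matrix.single i j (1 : ℂ) := by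
    rw [Matrix.transvection, Matrix.smul_single, smul_eq_mul, mul_one]
  rw [h, slotAct_one_add_smul]

/-- Entries of a transvection. [bookkeeping] -/
theorem transvection_apply' (p q : Fin m) (e : ℂ) (a b : Fin m) :
    Matrix.transvection p q e a b = (if a = b then 1 else 0) + if p = a ∧ q = b then e else 0 := by
  rw [Matrix.transvection, Matrix.add_apply, Matrix.one_apply, Matrix.single_apply]

/-- Upper root groups lie in the Borel subgroup. [bookkeeping] -/
theorem transvection_mem_borel {i j : Fin m} (hij : i < j) (c : ℂ) : Matrix.transvection i j c ∈ borel m := by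
  refine ⟨fun a b hba => ?_, fun a => ?_⟩
  · rw [transvection_apply', if_neg (ne_of_gt hba), zero_add, if_neg]
    rintro ⟨rfl, rfl⟩
    exact lt_asymm hij hba
  · rw [transvection_apply', if_pos rfl, if_neg, add_zero]
    · exact one_ne_zero
    · rintro ⟨rfl, h⟩
      exact (ne_of_lt hij) h.symm

/-- Root groups have trivial Borel character (unit diagonal). [bookkeeping] -/
theorem weightChar_transvection (lam : Fin m → ℕ) {i j : Fin m} (hij : i ≠ j) (c : ℂ) :
    weightChar lam (Matrix.transvection i j c) = 1 := by
  unfold weightChar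
  refine Finset.prod_eq_one fun a _ => ?_
  rw [transvection_apply', if_pos rfl, if_neg (fun h => hij (h.1.trans h.2.symm)), add_zero, one_pow]

/-! ### 3 · Chevalley's `SL₂` relation inside `GL_m` -/

/-- **The `SL₂` identity.**  For `i ≠ j` and `c ≠ 0`:
`E_{ji}(c⁻¹) = E_{ij}(c) · diag(−c at i, c⁻¹ at j, 1 elsewhere) · E_{ji}(c) · P_{(i j)}`.
(The last two factors equal `P_{(i j)} · E_{ij}(c)`; this is `e_{−α}(−t⁻¹) = e_α(−t) α^∨(t) w_α e_α(−t)` at `t = −c`.)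
[folklore: Chevalley relation in `SL₂`] -/
theorem transvection_inv_eq_prod {i j : Fin m} (hij : i ≠ j) {c : ℂ} (hc : c ≠ 0) :
    Matrix.transvection j i c⁻¹ =
      Matrix.transvection i j c *
        (Matrix.diagonal (fun a => if a = i then -c else if a = j then c⁻¹ else 1) *
          (Matrix.transvection j i c * (Equiv.swap i j).permMatrix ℂ)) := by
  set δ : Fin m → ℂ := fun a => if a = i then -c else if a = j then c⁻¹ else 1 with hδ
  have hδi : δ i = -c := by simp only [hδ, if_pos rfl]
  have hδj : δ j = c⁻¹ := by simp [hδ, hij.symm]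
  have hδo : ∀ a, a ≠ i → a ≠ j → δ a = 1 := fun a hai haj => by simp only [hδ, if_neg hai, if_neg haj]
  have hM : ∀ a b, (Matrix.diagonal δ * (Matrix.transvection j i c * (Equiv.swap i j).permMatrix ℂ)) a b =
      δ a * ((if a = Equiv.swap i j b then 1 else 0) + if j = a ∧ i = Equiv.swap i j b then c else 0) := by
    intro a b
    rw [Matrix.diagonal_mul, Equiv.Perm.permMatrix, PEquiv.mul_toMatrix_toPEquiv, Matrix.submatrix_apply,
      id_eq, Equiv.symm_swap, transvection_apply']
  ext a b
  rw [transvection_apply']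
  rcases eq_or_ne a i with hai | hai
  · rw [hai, Matrix.transvection_mul_apply_same, hM, hM, hδi, hδj]
    rcases eq_or_ne b i with hbi | hbi
    · rw [hbi, Equiv.swap_apply_left]
      simp [hij, hij.symm, hc]
    · rcases eq_or_ne b j with hbj | hbj
      · rw [hbj, Equiv.swap_apply_right]
        simp [hij, hij.symm, hc]
      · rw [Equiv.swap_apply_of_ne_of_ne hbi hbj]
        simp [hij.symm, Ne.symm hbi, Ne.symm hbj]
  · rw [Matrix.transvection_mul_apply_of_ne i j a b hai, hM]
    rcases eq_or_ne a j with haj | haj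
    · rw [haj, hδj]
      rcases eq_or_ne b i with hbi | hbi
      · rw [hbi, Equiv.swap_apply_left]
        simp [hij, hij.symm]
      · rcases eq_or_ne b j with hbj | hbj
        · rw [hbj, Equiv.swap_apply_right]
          simp [hij, hij.symm, hc]
        · rw [Equiv.swap_apply_of_ne_of_ne hbi hbj]
          simp [Ne.symm hbi, Ne.symm hbj]
    · rw [hδo a hai haj]
      rcases eq_or_ne b i with hbi | hbi
      · rw [hbi, Equiv.swap_apply_left]
        simp [hai, haj, Ne.symm haj]
      · rcases eq_or_ne b j with hbj | hbj
        · rw [hbj, Equiv.swap_apply_right]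
          simp [hai, haj, Ne.symm haj]
        · rw [Equiv.swap_apply_of_ne_of_ne hbi hbj]
          simp [Ne.symm haj]

/-! ### 4 · The Levi–Weyl law -/

/-- **Levi–Weyl law, ordered core.**  For a weight vector `f` of type `Λ`, a slot `s` and indices `i < j` with equal
exponents `Λ s i = Λ s j`: (A) `f` is invariant under the LOWER root group `E_{ji}(u)`, and (B) the transposition matrix
`P_{(i j)}` acts on `f` by the sign `(−1)^{Λ s i}`. [this node; cite: Grosshans1997, Cor. 3.6; BurgisserIkenmeyer2011, §3.1–3.2] -/
theorem leviWeyl_pair {Λ : Fin 3 → Fin m → ℕ} {d : ℕ} {f : MvPolynomial (Idx m) ℂ} (hf : f ∈ hwvSpace Λ d)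
    (s : Fin 3) {i j : Fin m} (hij : i < j) (hΛ : Λ s i = Λ s j) (x : Tensor ℂ m) :
    (∀ u : ℂ, evalT (slotAct s (Matrix.transvection j i u) x) f = evalT x f) ∧
      evalT (slotAct s ((Equiv.swap i j).permMatrix ℂ) x) f = (-1) ^ Λ s i * evalT x f := by
  have hne : i ≠ j := ne_of_lt hij
  obtain ⟨P, hP⟩ := exists_polynomial_evalT_line f x (slotAct s (Matrix.single j i (1 : ℂ)) x)
  obtain ⟨Q, hQ⟩ := exists_polynomial_evalT_line f (slotAct s ((Equiv.swap i j).permMatrix ℂ) x)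
    (slotAct s (Matrix.single j i (1 : ℂ)) (slotAct s ((Equiv.swap i j).permMatrix ℂ) x))
  have hP' : ∀ u, evalT (slotAct s (Matrix.transvection j i u) x) f = P.eval u := fun u => by
    rw [slotAct_transvection, hP]
  have hQ' : ∀ u, evalT (slotAct s (Matrix.transvection j i u)
      (slotAct s ((Equiv.swap i j).permMatrix ℂ) x)) f = Q.eval u := fun u => by
    rw [slotAct_transvection, hQ]
  -- the `SL₂` identity, evaluated on `f`
  have key : ∀ c : ℂ, c ≠ 0 → P.eval c⁻¹ = (Polynomial.C ((-1 : ℂ) ^ Λ s i) * Q).eval c := by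
    intro c hc
    have hid := transvection_inv_eq_prod hne hc
    set δ : Fin m → ℂ := fun a => if a = i then -c else if a = j then c⁻¹ else 1 with hδ
    have hδ0 : ∀ a, δ a ≠ 0 := fun a => by
      simp only [hδ]
      split_ifs
      · exact neg_ne_zero.2 hc
      · exact inv_ne_zero hc
      · exact one_ne_zero
    have hwD : weightChar (Λ s) (Matrix.diagonal δ) = (-1) ^ Λ s i := by
      rw [weightChar_diagonal, Finset.prod_eq_mul i j hne, ← hΛ]
      · have hi : δ i = -c := by simp only [hδ, if_pos rfl]
        have hj : δ j = c⁻¹ := by simp [hδ, hne.symm]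
        rw [hi, hj, ← mul_pow, neg_mul, mul_inv_cancel₀ hc]
      · intro a _ ha
        have : δ a = 1 := by simp only [hδ, if_neg ha.1, if_neg ha.2]
        rw [this, one_pow]
      · exact fun h => (h (Finset.mem_univ _)).elim
      · exact fun h => (h (Finset.mem_univ _)).elim
    rw [← hP', hid, ← slotAct_mul _ _ _ s, ← slotAct_mul _ _ _ s, ← slotAct_mul _ _ _ s,
      evalT_slotAct hf (transvection_mem_borel hij c) _ s, evalT_slotAct hf (diagonal_mem_borel hδ0) _ s,
      weightChar_transvection _ hne, hwD, hQ', one_mul, Polynomial.eval_mul, Polynomial.eval_C]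
  -- Laurent rigidity: both restrictions are constant
  have hrig := fun u => eval_eq_eval_zero_of_eval_inv_eq key u
  have hP0 : P.eval 0 = evalT x f := by rw [← hP', Matrix.transvection_zero, slotAct_id]
  have hQ0 : Q.eval 0 = evalT (slotAct s ((Equiv.swap i j).permMatrix ℂ) x) f := by
    rw [← hQ', Matrix.transvection_zero, slotAct_id]
  refine ⟨fun u => by rw [hP', (hrig u).1, hP0], ?_⟩
  have h2 := (hrig 0).2
  rw [Polynomial.eval_mul, Polynomial.eval_C, hQ0, hP0] at h2
  -- h2 : (-1)^ℓ * f(P·x) = f(x)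
  have hsq : ((-1 : ℂ) ^ Λ s i) * (-1) ^ Λ s i = 1 := by
    rw [← mul_pow, neg_one_mul, neg_neg, one_pow]
  calc evalT (slotAct s ((Equiv.swap i j).permMatrix ℂ) x) f
      = (((-1 : ℂ) ^ Λ s i) * (-1) ^ Λ s i) * evalT (slotAct s ((Equiv.swap i j).permMatrix ℂ) x) f := by
          rw [hsq, one_mul]
    _ = (-1) ^ Λ s i * evalT x f := by rw [mul_assoc, h2]

/-- **Levi–Weyl law (A): root-group invariance.**  A weight vector is invariant under `E_{ij}(u)` in slot `s`
whenever `Λ s i = Λ s j` (`i ≠ j`, either order). [cite: Grosshans1997, Cor. 3.6 (`U_{−α} ⊆ Stab(v_χ)` iff `(χ,α) = 0`)] -/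
theorem evalT_slotAct_transvection {Λ : Fin 3 → Fin m → ℕ} {d : ℕ} {f : MvPolynomial (Idx m) ℂ}
    (hf : f ∈ hwvSpace Λ d) (s : Fin 3) {i j : Fin m} (hij : i ≠ j) (hΛ : Λ s i = Λ s j) (u : ℂ)
    (x : Tensor ℂ m) : evalT (slotAct s (Matrix.transvection i j u) x) f = evalT x f := by
  rcases lt_or_gt_of_ne hij with h | h
  · rw [evalT_slotAct hf (transvection_mem_borel h u) x s, weightChar_transvection _ hij, one_mul]
  · exact (leviWeyl_pair hf s h hΛ.symm x).1 u

/-- **Levi–Weyl law (B): the sign law.**  The transposition matrix `P_{(i j)}` in slot `s` acts on a weight vector by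
`(−1)^{Λ s i}` whenever `Λ s i = Λ s j`. [this node] -/
theorem evalT_slotAct_swap {Λ : Fin 3 → Fin m → ℕ} {d : ℕ} {f : MvPolynomial (Idx m) ℂ}
    (hf : f ∈ hwvSpace Λ d) (s : Fin 3) {i j : Fin m} (hij : i ≠ j) (hΛ : Λ s i = Λ s j)
    (x : Tensor ℂ m) :
    evalT (slotAct s ((Equiv.swap i j).permMatrix ℂ) x) f = (-1) ^ Λ s i * evalT x f := by
  rcases lt_or_gt_of_ne hij with h | h
  · exact (leviWeyl_pair hf s h hΛ x).2
  · rw [Equiv.swap_comm, hΛ]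
    exact (leviWeyl_pair hf s h hΛ.symm x).2

/-- **Levi–Weyl law (B′): Weyl group of a level set.**  A permutation `σ` moving only indices of ONE level set
`{a | Λ s a = ℓ}` acts in slot `s` on a weight vector by `sign(σ)^ℓ`. [this node] -/
theorem evalT_slotAct_permMatrix {Λ : Fin 3 → Fin m → ℕ} {d : ℕ} {f : MvPolynomial (Idx m) ℂ}
    (hf : f ∈ hwvSpace Λ d) (s : Fin 3) {ℓ : ℕ} (σ : Equiv.Perm (Fin m))
    (hσ : ∀ a, σ a ≠ a → Λ s a = ℓ) (x : Tensor ℂ m) :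
    evalT (slotAct s (σ.permMatrix ℂ) x) f = ((Equiv.Perm.sign σ : ℤ) : ℂ) ^ ℓ * evalT x f := by
  classical
  have h₁ : ∀ a, Λ s (σ a) = ℓ ↔ Λ s a = ℓ := by
    intro a
    by_cases ha : σ a = a
    · rw [ha]
    · exact ⟨fun _ => hσ a ha, fun _ => hσ (σ a) fun h => ha (σ.injective h)⟩
  obtain ⟨τ, rfl⟩ : ∃ τ : Equiv.Perm {a // Λ s a = ℓ}, Equiv.Perm.ofSubtype τ = σ :=
    ⟨σ.subtypePerm h₁, Equiv.Perm.ofSubtype_subtypePerm h₁ hσ⟩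
  revert x
  refine Equiv.Perm.swap_induction_on τ ?_ ?_
  · intro x
    rw [map_one, Matrix.permMatrix_one, slotAct_id, Equiv.Perm.sign_one, Units.val_one, Int.cast_one,
      one_pow, one_mul]
  · intro τ a b hab ih x
    have hab' : (a : Fin m) ≠ b := fun h => hab (Subtype.ext h)
    rw [map_mul, Equiv.Perm.ofSubtype_swap_eq, Matrix.permMatrix_mul, ← slotAct_mul _ _ _ s, ih,
      evalT_slotAct_swap hf s hab' (by rw [a.2, b.2]) x, a.2, Equiv.Perm.sign_mul,
      Equiv.Perm.sign_swap hab']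
    push_cast
    ring

/-! ### 5 · Consequences for the invariant tower -/

/-- **(C) Odd-symmetry vanishing** («(PP) law»).  If `x` is fixed by the simultaneous relabelling by an ODD
permutation `σ` supported in the corner block, every weight vector of rectangular type of ODD level `k` vanishes at
`x`. [this node] -/
theorem evalT_eq_zero_of_oddSymmetry {N k d : ℕ} (hk : Odd k) {f : MvPolynomial (Idx m) ℂ}
    (hf : f ∈ hwvSpace (rectType m N k) d) (σ : Equiv.Perm (Fin m))
    (hσ : ∀ a, σ a ≠ a → m ≤ (a : ℕ) + N) (hsign : Equiv.Perm.sign σ = -1) {x : Tensor ℂ m}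
    (hx : actTensor (σ.permMatrix ℂ) (σ.permMatrix ℂ) (σ.permMatrix ℂ) x = x) : evalT x f = 0 := by
  have hσ' : ∀ s : Fin 3, ∀ a, σ a ≠ a → rectType m N k s a = k := fun s a ha => by
    simp only [rectType, if_pos (hσ a ha)]
  have h3 : actTensor (σ.permMatrix ℂ) (σ.permMatrix ℂ) (σ.permMatrix ℂ) x =
      slotAct 0 (σ.permMatrix ℂ) (slotAct 1 (σ.permMatrix ℂ) (slotAct 2 (σ.permMatrix ℂ) x)) := by
    simp only [slotAct_zero, slotAct_one, slotAct_two, actTensor_actTensor, Matrix.mul_one, Matrix.one_mul]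
  have key : evalT x f = -evalT x f := by
    conv_lhs => rw [← hx, h3]
    rw [evalT_slotAct_permMatrix hf 0 σ (hσ' 0), evalT_slotAct_permMatrix hf 1 σ (hσ' 1),
      evalT_slotAct_permMatrix hf 2 σ (hσ' 2), hsign]
    push_cast
    rw [hk.neg_one_pow]
    ring
  exact add_self_eq_zero.1 (eq_neg_iff_add_eq_zero.1 key)

/-- **(C′)** Hence an odd level is not a level of such a point: `k ∉ pointLevels N x`. [this node] -/
theorem not_mem_pointLevels_of_oddSymmetry {N k : ℕ} (hk : Odd k) (σ : Equiv.Perm (Fin m))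
    (hσ : ∀ a, σ a ≠ a → m ≤ (a : ℕ) + N) (hsign : Equiv.Perm.sign σ = -1) {x : Tensor ℂ m}
    (hx : actTensor (σ.permMatrix ℂ) (σ.permMatrix ℂ) (σ.permMatrix ℂ) x = x) :
    k ∉ pointLevels N x := by
  rintro ⟨f, hf, hne⟩
  exact hne (evalT_eq_zero_of_oddSymmetry hk hf σ hσ hsign hx)

/-- **(D₁)** The levels of a point are invariant under one-slot Borel moves. [this node] -/
theorem pointLevels_slotAct_borel (N : ℕ) (s : Fin 3) {b : Matrix (Fin m) (Fin m) ℂ} (hb : b ∈ borel m)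
    (t : Tensor ℂ m) : pointLevels N (slotAct s b t) = pointLevels N t := by
  ext k
  refine exists_congr fun f => and_congr_right fun hf => ?_
  rw [evalT_slotAct hf hb t s]
  exact ⟨fun h => (mul_ne_zero_iff.1 h).2, fun h => mul_ne_zero (weightChar_ne_zero _ hb) h⟩

/-- Two indices in the same block (both in the corner or both before it) carry the same rectangular exponent.
[bookkeeping] -/
theorem rectType_eq_of_iff {N k : ℕ} (s : Fin 3) {i j : Fin m}
    (hblk : m ≤ (i : ℕ) + N ↔ m ≤ (j : ℕ) + N) : rectType m N k s i = rectType m N k s j := by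
  unfold rectType
  by_cases h : m ≤ (j : ℕ) + N
  · rw [if_pos h, if_pos (hblk.2 h)]
  · rw [if_neg h, if_neg (mt hblk.1 h)]

/-- **(D₂)** The levels of a point are invariant under the root groups `E_{ij}(u)` of the block Levi (both indices in
the corner, or both before it), in any slot. [this node] -/
theorem pointLevels_slotAct_transvection (N : ℕ) (s : Fin 3) {i j : Fin m} (hij : i ≠ j)
    (hblk : m ≤ (i : ℕ) + N ↔ m ≤ (j : ℕ) + N) (u : ℂ) (t : Tensor ℂ m) :
    pointLevels N (slotAct s (Matrix.transvection i j u) t) = pointLevels N t := by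
  ext k
  refine exists_congr fun f => and_congr_right fun hf => ?_
  rw [evalT_slotAct_transvection hf s hij (rectType_eq_of_iff s hblk) u t]

/-- **(D₃)** The levels of a point are invariant under corner permutations in any slot. [this node] -/
theorem pointLevels_slotAct_permMatrix (N : ℕ) (s : Fin 3) (σ : Equiv.Perm (Fin m))
    (hσ : ∀ a, σ a ≠ a → m ≤ (a : ℕ) + N) (t : Tensor ℂ m) :
    pointLevels N (slotAct s (σ.permMatrix ℂ) t) = pointLevels N t := by
  ext k
  refine exists_congr fun f => and_congr_right fun hf => ?_
  have hσ' : ∀ a, σ a ≠ a → rectType m N k s a = k := fun a ha => by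
    simp only [rectType, if_pos (hσ a ha)]
  rw [evalT_slotAct_permMatrix hf s σ hσ' t]
  have hu : (((Equiv.Perm.sign σ : ℤ) : ℂ)) ^ k ≠ 0 := by
    refine pow_ne_zero _ ?_
    rcases Int.units_eq_one_or (Equiv.Perm.sign σ) with h | h <;> simp [h]
  exact ⟨fun h => (mul_ne_zero_iff.1 h).2, fun h => mul_ne_zero hu h⟩

end LeviWeyl

end Summit.MatrixMultiplication.MatrixMultiplication.Theorems.ObstructionCalculus
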